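import Literature.Topology.FourManifolds.PlanarArch
import Literature.Topology.FourManifolds.SeifertLevelSurface
import Literature.Topology.FourManifolds.CollarUniquenessBall
import Mathlib.Analysis.SpecialFunctions.ExpDeriv
import HarnessLib

/-!
# Setting up the Morse-theoretic trisection, III: the profile functions (real analysis)

Topic `Literature/Topology/FourManifolds`; step H (part b-3) of a Morse-theoretic construction of
Gay–Kirby's trisection for the fact seat
`provefact-Literature.Topology.FourManifolds.exists_isBalancedGKTrisection` (Gay–Kirby 2016,
Thm. 4 via §4, Lemma 14).  Everything in this file is **proved**; the definitions are explicit
smooth functions of one real variable built from the smooth step `smoothStep a b`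
(`PlanarArch.lean`, Mathlib's `Real.smoothTransition`) and the smooth step down `stepDown`
(`SeifertLevelSurface.lean`); all names live in the namespace `TriProfile`.

The sector functions, the top height and the top-face function of the construction
(`TrisectionsTopHeight*.lean`, `TrisectionsSector*.lean`, `TrisectionsTopFace*.lean`) are built
from profile functions subject to the design hypotheses collected in `BiCollar.TriSetup`
(`TrisectionsClauses.lean`).  This file supplies them:

* `abs_deriv_smoothStep_le` — `|(smoothStep a b)'| ≤ C/(b - a)` for the tree's bound `C = smoothTransitionDerivBound`
  of `|smoothTransition'|` (`CollarUniquenessBall.lean`);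
* lemmas on the tree's smooth step down `stepDown a b = 1 - smoothStep a b` (`SeifertLevelSurface.lean`);
* `tpProfile` — the tube profile `T_P` of the top height: affine `S_top - P/β₀` on `(-∞, P₁]`,
  constant `S_pl` on `[2P₁, ∞)`, nonincreasing, positive;
* `wProfile` — the weight profile `w`: `w ≥ w_b > 0`, `|w'| ≤ λ_w (1 + C)`, `w' < 0` left of the
  window `[b - ε_w, ∞)` on which `w ≡ w_b`;
* `rhoProfile` — the smoothed angular radius `ρ`: `ρ = 1/A` on `[a_R/2, ∞)`, constant on
  `(-∞, a_R/4]`, positive, nonincreasing, with `|(A ρ)'| ≤ 16(3 + 2C)/a_R` on `[0, a_R]`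
  (`abs_rho_add_mul_deriv_le`);
* `chibProfile` — the belt cut-off `χ_b`: a step down from `1` to `0` on `[a_R/4, a_R/2]`;
* `radialProfile` — the radial correction `R₀`: `exp(L(a_R' - a))` on `(-∞, a_R' - w₀]`, `1` on
  `[a_R', ∞)`, `≥ 1`, nonincreasing;
* `uProfile` — the outer factor `U` of the first and third sector functions: the identity on
  `(-∞, u₀]`, `1` on `[u₁, ∞)` (`u₀ < u₁ ≤ 1`), positive on `(0, ∞)`, nondecreasing.

## References

* D. Gay, R. Kirby, *Trisecting 4-manifolds*, Geom. Topol. 20 (2016), §4, Lemma 14. [GayKirby2016]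
-/

open scoped ContDiff Topology
open Set Function Real Filter

noncomputable section

namespace Literature.Topology.FourManifolds

namespace TriProfile

/-! ### The bound for the derivative of the smooth transition -/

/-- `|smoothTransition' x| ≤ C₀`, the tree's bound `smoothTransitionDerivBound` (`CollarUniquenessBall.lean`)
in absolute-value form. [folklore] -/
theorem abs_deriv_smoothTransition_le_bound (x : ℝ) : |deriv smoothTransition x| ≤ smoothTransitionDerivBound := by
  have h := norm_deriv_smoothTransition_le x
  rwa [Real.norm_eq_abs] at h

/-- **`|(smoothStep a b)' x| ≤ C/(b - a)`** (`a < b`). [folklore] -/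
theorem abs_deriv_smoothStep_le {a b : ℝ} (hab : a < b) (x : ℝ) : |deriv (smoothStep a b) x| ≤ smoothTransitionDerivBound / (b - a) := by
  rw [(hasDerivAt_smoothStep a b x).deriv, abs_mul, abs_of_pos (inv_pos.2 (sub_pos.2 hab)), div_eq_mul_inv]
  exact mul_le_mul_of_nonneg_right (abs_deriv_smoothTransition_le_bound _) (inv_nonneg.2 (by linarith))

/-- `0 ≤ (smoothStep a b)' x ≤ C/(b - a)`. [folklore] -/
theorem deriv_smoothStep_le {a b : ℝ} (hab : a < b) (x : ℝ) : deriv (smoothStep a b) x ≤ smoothTransitionDerivBound / (b - a) :=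
  (le_abs_self _).trans (abs_deriv_smoothStep_le hab x)

/-! ### The smooth step down (the tree's `stepDown a b = 1 - smoothStep a b`, `SeifertLevelSurface.lean`) -/

section StepDown

variable {a b : ℝ}

/-- Unfolding. [folklore] -/
theorem stepDown_apply (a b x : ℝ) : stepDown a b x = 1 - smoothStep a b x := rfl

/-- Values in `[0, 1]`. [folklore] -/
theorem stepDown_mem_Icc (a b x : ℝ) : stepDown a b x ∈ Icc 0 1 := by
  obtain ⟨h0, h1⟩ := smoothStep_mem_Icc a b x
  rw [stepDown_apply]; exact ⟨by linarith, by linarith⟩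

/-- The derivative. [folklore] -/
theorem hasDerivAt_stepDown (a b x : ℝ) : HasDerivAt (stepDown a b) (-deriv (smoothStep a b) x) x := by
  have := (differentiable_smoothStep a b x).hasDerivAt.const_sub 1
  exact this

/-- The derivative, `deriv` form. [folklore] -/
theorem deriv_stepDown (a b x : ℝ) : deriv (stepDown a b) x = -deriv (smoothStep a b) x := (hasDerivAt_stepDown a b x).deriv

/-- Nonincreasing: `(stepDown a b)' ≤ 0`. [folklore] -/
theorem deriv_stepDown_nonpos (hab : a < b) (x : ℝ) : deriv (stepDown a b) x ≤ 0 := by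
  rw [deriv_stepDown]; linarith [deriv_smoothStep_nonneg hab x]

/-- `|(stepDown a b)'| ≤ C/(b - a)`. [folklore] -/
theorem abs_deriv_stepDown_le (hab : a < b) (x : ℝ) : |deriv (stepDown a b) x| ≤ smoothTransitionDerivBound / (b - a) := by
  rw [deriv_stepDown, abs_neg]; exact abs_deriv_smoothStep_le hab x

/-- Differentiable. [folklore] -/
theorem differentiable_stepDown (a b : ℝ) : Differentiable ℝ (stepDown a b) := (contDiff_stepDown a b).differentiable (by simp)

end StepDown

/-! ### The tube profile `T_P` -/

/-- **The tube profile of the top height**: `T_P(P) = S_pl + (S_top - P/β₀ - S_pl) · stepDown P₁ (2P₁) P`,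
i.e. `S_top - P/β₀` for `P ≤ P₁`, `S_pl` for `P ≥ 2P₁`. [cite: GayKirby2016, §4, Lemma 14] -/
def tpProfile (Stop β₀ Spl P₁ P : ℝ) : ℝ := Spl + (Stop - P / β₀ - Spl) * stepDown P₁ (2 * P₁) P

section TP

variable {Stop β₀ Spl P₁ : ℝ}

/-- Unfolding. [folklore] -/
theorem tpProfile_apply (Stop β₀ Spl P₁ P : ℝ) :
    tpProfile Stop β₀ Spl P₁ P = Spl + (Stop - P / β₀ - Spl) * stepDown P₁ (2 * P₁) P := rfl

/-- **Affine below `P₁`.** [folklore] -/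
theorem tpProfile_of_le (hP₁ : 0 < P₁) {P : ℝ} (hP : P ≤ P₁) : tpProfile Stop β₀ Spl P₁ P = Stop - P / β₀ := by
  rw [tpProfile_apply, stepDown_of_le (by linarith) hP]; ring

/-- **Constant above `2P₁`.** [folklore] -/
theorem tpProfile_of_ge (hP₁ : 0 < P₁) {P : ℝ} (hP : 2 * P₁ ≤ P) : tpProfile Stop β₀ Spl P₁ P = Spl := by
  rw [tpProfile_apply, stepDown_of_ge (by linarith) hP]; ring

/-- Smooth. [folklore] -/
theorem contDiff_tpProfile (Stop β₀ Spl P₁ : ℝ) : ContDiff ℝ ∞ (tpProfile Stop β₀ Spl P₁) := by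
  unfold tpProfile
  exact contDiff_const.add (((contDiff_const.sub (contDiff_id.div_const _)).sub contDiff_const).mul (contDiff_stepDown _ _))

/-- The derivative of `T_P`. [folklore] -/
theorem hasDerivAt_tpProfile (Stop β₀ Spl P₁ P : ℝ) :
    HasDerivAt (tpProfile Stop β₀ Spl P₁)
      (-(1 / β₀) * stepDown P₁ (2 * P₁) P + (Stop - P / β₀ - Spl) * deriv (stepDown P₁ (2 * P₁)) P) P := by
  have h1 : HasDerivAt (fun Q : ℝ => Stop - Q / β₀ - Spl) (-(1 / β₀)) P :=
    ((((hasDerivAt_id' P).div_const β₀).const_sub Stop).sub_const Spl).congr_deriv (by ring)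
  have h2 := (differentiable_stepDown P₁ (2 * P₁) P).hasDerivAt
  exact ((h1.mul h2).const_add Spl).congr_deriv (by ring)

/-- **`T_P` is nonincreasing** when `β₀ > 0` and `S_top - 2P₁/β₀ ≥ S_pl`. [folklore] -/
theorem deriv_tpProfile_nonpos (hβ₀ : 0 < β₀) (hP₁ : 0 < P₁) (hdec : Spl ≤ Stop - 2 * P₁ / β₀) (P : ℝ) :
    deriv (tpProfile Stop β₀ Spl P₁) P ≤ 0 := by
  rw [(hasDerivAt_tpProfile Stop β₀ Spl P₁ P).deriv]
  have hsd := stepDown_mem_Icc P₁ (2 * P₁) P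
  have h1 : -(1 / β₀) * stepDown P₁ (2 * P₁) P ≤ 0 := by
    have : 0 ≤ 1 / β₀ := by positivity
    nlinarith [hsd.1]
  have h2 : (Stop - P / β₀ - Spl) * deriv (stepDown P₁ (2 * P₁)) P ≤ 0 := by
    by_cases hP : P < 2 * P₁
    · -- there `S_top - P/β₀ - S_pl ≥ 0`
      have hnum : 0 ≤ Stop - P / β₀ - Spl := by
        have : P / β₀ ≤ 2 * P₁ / β₀ := div_le_div_of_nonneg_right hP.le hβ₀.le
        linarith
      exact mul_nonpos_of_nonneg_of_nonpos hnum (deriv_stepDown_nonpos (by linarith) P)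
    · push Not at hP
      rcases hP.lt_or_eq with hP | hP
      · rw [deriv_stepDown, deriv_smoothStep_of_gt (by linarith) hP, neg_zero, mul_zero]
      · rw [← hP, deriv_stepDown, deriv_smoothStep_right (by linarith), neg_zero, mul_zero]
  linarith

/-- **`T_P ≥ S_pl` on `(-∞, 2P₁]` and `= S_pl` beyond; in particular `T_P > 0` if `S_pl > 0`**
(`β₀ > 0`, `S_top - 2P₁/β₀ ≥ S_pl`). [folklore] -/
theorem le_tpProfile (hβ₀ : 0 < β₀) (hP₁ : 0 < P₁) (hdec : Spl ≤ Stop - 2 * P₁ / β₀) (P : ℝ) :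
    Spl ≤ tpProfile Stop β₀ Spl P₁ P := by
  rw [tpProfile_apply]
  have hsd := stepDown_mem_Icc P₁ (2 * P₁) P
  by_cases hP : P ≤ 2 * P₁
  · have hnum : 0 ≤ Stop - P / β₀ - Spl := by
      have : P / β₀ ≤ 2 * P₁ / β₀ := div_le_div_of_nonneg_right hP hβ₀.le
      linarith
    nlinarith [hsd.1]
  · push Not at hP
    rw [stepDown_of_ge (by linarith) hP.le]; linarith

/-- `T_P ≤ S_top` on `[0, ∞)` when `S_pl ≤ S_top` (`β₀ > 0`). [folklore] -/
theorem tpProfile_le (hβ₀ : 0 < β₀) (hSpl : Spl ≤ Stop) {P : ℝ} (hP : 0 ≤ P) :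
    tpProfile Stop β₀ Spl P₁ P ≤ Stop := by
  rw [tpProfile_apply]
  have hsd := stepDown_mem_Icc P₁ (2 * P₁) P
  have hdiv : 0 ≤ P / β₀ := div_nonneg hP hβ₀.le
  by_cases hnum : 0 ≤ Stop - P / β₀ - Spl
  · nlinarith [hsd.2]
  · push Not at hnum
    nlinarith [hsd.1]

end TP

/-! ### The weight profile `w` -/

/-- The germ `G(x) = x · smoothStep 0 1 x`: `0` for `x ≤ 0`, `x` for `x ≥ 1`, nondecreasing, with
`G' > 0` on `(0, ∞)`. [folklore] -/
def wGerm (x : ℝ) : ℝ := x * smoothStep 0 1 x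

/-- Smooth. [folklore] -/
theorem contDiff_wGerm : ContDiff ℝ ∞ wGerm := contDiff_id.mul (contDiff_smoothStep 0 1)

/-- `G = 0` on `(-∞, 0]`. [folklore] -/
theorem wGerm_of_nonpos {x : ℝ} (hx : x ≤ 0) : wGerm x = 0 := by
  rw [wGerm, smoothStep_of_le one_pos hx, mul_zero]

/-- The derivative of `G`. [folklore] -/
theorem hasDerivAt_wGerm (x : ℝ) : HasDerivAt wGerm (smoothStep 0 1 x + x * deriv (smoothStep 0 1) x) x := by
  exact ((hasDerivAt_id' x).mul (differentiable_smoothStep 0 1 x).hasDerivAt).congr_deriv (by ring)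

/-- `G' ≥ 0`. [folklore] -/
theorem deriv_wGerm_nonneg (x : ℝ) : 0 ≤ deriv wGerm x := by
  rw [(hasDerivAt_wGerm x).deriv]
  have h1 := (smoothStep_mem_Icc 0 1 x).1
  by_cases hx : 0 ≤ x
  · exact add_nonneg h1 (mul_nonneg hx (deriv_smoothStep_nonneg one_pos x))
  · push Not at hx
    rw [deriv_smoothStep_of_lt one_pos hx, mul_zero, add_zero]; exact h1

/-- **`G' > 0` on `(0, ∞)`.** [folklore] -/
theorem deriv_wGerm_pos {x : ℝ} (hx : 0 < x) : 0 < deriv wGerm x := by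
  rw [(hasDerivAt_wGerm x).deriv]
  have h2 : 0 ≤ x * deriv (smoothStep 0 1) x := mul_nonneg hx.le (deriv_smoothStep_nonneg one_pos x)
  have h1 : 0 < smoothStep 0 1 x := by
    by_cases hx1 : x < 1
    · exact (smoothStep_mem_Ioo one_pos ⟨hx, hx1⟩).1
    · push Not at hx1; rw [smoothStep_of_ge one_pos hx1]; exact one_pos
  linarith

/-- `G' = 0` on `(-∞, 0)`. [folklore] -/
theorem deriv_wGerm_of_neg {x : ℝ} (hx : x < 0) : deriv wGerm x = 0 := by
  have : wGerm =ᶠ[𝓝 x] fun _ => 0 := Filter.eventuallyEq_of_mem (Iio_mem_nhds hx) fun y hy => wGerm_of_nonpos (le_of_lt hy)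
  rw [this.deriv_eq, deriv_const]

/-- **`|G'| ≤ 1 + C`.** [folklore] -/
theorem abs_deriv_wGerm_le (x : ℝ) : |deriv wGerm x| ≤ 1 + smoothTransitionDerivBound := by
  rw [abs_of_nonneg (deriv_wGerm_nonneg x), (hasDerivAt_wGerm x).deriv]
  have h1 := (smoothStep_mem_Icc 0 1 x).2
  have h2 : x * deriv (smoothStep 0 1) x ≤ smoothTransitionDerivBound := by
    by_cases hx : x ∈ Icc (0 : ℝ) 1
    · calc x * deriv (smoothStep 0 1) x ≤ 1 * deriv (smoothStep 0 1) x :=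
            mul_le_mul_of_nonneg_right hx.2 (deriv_smoothStep_nonneg one_pos x)
        _ ≤ smoothTransitionDerivBound / (1 - 0) := by rw [one_mul]; exact deriv_smoothStep_le one_pos x
        _ = smoothTransitionDerivBound := by norm_num
    · rcases not_and_or.1 hx with h | h
      · push Not at h; rw [deriv_smoothStep_of_lt one_pos h, mul_zero]; exact smoothTransitionDerivBound_pos.le
      · push Not at h; rw [deriv_smoothStep_of_gt one_pos h, mul_zero]; exact smoothTransitionDerivBound_pos.le
  linarith

/-- **The weight profile** `w(t) = w_b + λ_w G(c - t)`: constant `w_b` on `[c, ∞)`, strictly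
decreasing on `(-∞, c)`. [cite: GayKirby2016, §4, Lemma 14] -/
def wProfile (wb lw c t : ℝ) : ℝ := wb + lw * wGerm (c - t)

section W

variable {wb lw c : ℝ}

/-- Smooth. [folklore] -/
theorem contDiff_wProfile (wb lw c : ℝ) : ContDiff ℝ ∞ (wProfile wb lw c) := by
  unfold wProfile
  exact contDiff_const.add (contDiff_const.mul (contDiff_wGerm.comp (contDiff_const.sub contDiff_id)))

/-- **`w = w_b` on `[c, ∞)`.** [folklore] -/
theorem wProfile_of_ge {t : ℝ} (ht : c ≤ t) : wProfile wb lw c t = wb := by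
  rw [wProfile, wGerm_of_nonpos (by linarith), mul_zero, add_zero]

/-- **`w ≥ w_b`** (`λ_w ≥ 0`). [folklore] -/
theorem le_wProfile (hlw : 0 ≤ lw) (t : ℝ) : wb ≤ wProfile wb lw c t := by
  rw [wProfile]
  have : 0 ≤ wGerm (c - t) := by
    rw [wGerm]; by_cases h : c - t ≤ 0
    · rw [smoothStep_of_le one_pos h, mul_zero]
    · push Not at h; exact mul_nonneg h.le (smoothStep_mem_Icc 0 1 _).1
  nlinarith

/-- The derivative of `w`. [folklore] -/
theorem hasDerivAt_wProfile (wb lw c t : ℝ) : HasDerivAt (wProfile wb lw c) (-(lw * deriv wGerm (c - t))) t := by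
  have hG : HasDerivAt wGerm (deriv wGerm (c - t)) (c - t) := (contDiff_wGerm.differentiable (by simp) _).hasDerivAt
  have hl : HasDerivAt (fun s : ℝ => c - s) (-1) t := by simpa using (hasDerivAt_id t).const_sub c
  exact (((hG.comp t hl).const_mul lw).const_add wb).congr_deriv (by ring)

/-- **`w' ≤ 0`** (`λ_w ≥ 0`). [folklore] -/
theorem deriv_wProfile_nonpos (hlw : 0 ≤ lw) (t : ℝ) : deriv (wProfile wb lw c) t ≤ 0 := by
  rw [(hasDerivAt_wProfile wb lw c t).deriv]
  have := mul_nonneg hlw (deriv_wGerm_nonneg (c - t))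
  linarith

/-- **`w' < 0` on `(-∞, c)`** (`λ_w > 0`). [folklore] -/
theorem deriv_wProfile_neg (hlw : 0 < lw) {t : ℝ} (ht : t < c) : deriv (wProfile wb lw c) t < 0 := by
  rw [(hasDerivAt_wProfile wb lw c t).deriv]
  have := mul_pos hlw (deriv_wGerm_pos (x := c - t) (by linarith))
  linarith

/-- **`|w'| ≤ λ_w (1 + C)`** (`λ_w ≥ 0`). [folklore] -/
theorem abs_deriv_wProfile_le (hlw : 0 ≤ lw) (t : ℝ) : |deriv (wProfile wb lw c) t| ≤ lw * (1 + smoothTransitionDerivBound) := by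
  rw [(hasDerivAt_wProfile wb lw c t).deriv, abs_neg, abs_mul, abs_of_nonneg hlw]
  exact mul_le_mul_of_nonneg_left (abs_deriv_wGerm_le _) hlw

end W

/-! ### The smoothed angular radius `ρ` -/

/-- The smoothed radius `m(A) = A s(A) + m₀ (1 - s(A))`, `s = smoothStep a₀ a₁`: `m₀` on
`(-∞, a₀]`, `A` on `[a₁, ∞)`. [folklore] -/
def mProfile (m₀ a₀ a₁ A : ℝ) : ℝ := A * smoothStep a₀ a₁ A + m₀ * (1 - smoothStep a₀ a₁ A)

/-- **The smoothed angular radius** `ρ = 1/m`. [cite: GayKirby2016, §4, Lemma 14] -/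
def rhoProfile (m₀ a₀ a₁ A : ℝ) : ℝ := (mProfile m₀ a₀ a₁ A)⁻¹

section Rho

variable {m₀ a₀ a₁ : ℝ}

/-- `m = m₀` on `(-∞, a₀]`. [folklore] -/
theorem mProfile_of_le (ha : a₀ < a₁) {A : ℝ} (hA : A ≤ a₀) : mProfile m₀ a₀ a₁ A = m₀ := by
  rw [mProfile, smoothStep_of_le ha hA]; ring

/-- `m = A` on `[a₁, ∞)`. [folklore] -/
theorem mProfile_of_ge (ha : a₀ < a₁) {A : ℝ} (hA : a₁ ≤ A) : mProfile m₀ a₀ a₁ A = A := by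
  rw [mProfile, smoothStep_of_ge ha hA]; ring

/-- **`m ≥ m₀` when `0 < m₀ ≤ a₀`** (a convex combination of `A ≥ a₀ ≥ m₀` and `m₀` past `a₀`). [folklore] -/
theorem le_mProfile (ha : a₀ < a₁) (hm : m₀ ≤ a₀) (A : ℝ) : m₀ ≤ mProfile m₀ a₀ a₁ A := by
  by_cases hA : A ≤ a₀
  · rw [mProfile_of_le ha hA]
  · push Not at hA
    rw [mProfile]
    have hs := smoothStep_mem_Icc a₀ a₁ A
    nlinarith [hs.1, hs.2]

/-- `m ≤ max A m₀`-type bound: `m ≤ A` for `A ≥ m₀`... precisely `m ≤ A + m₀` for `A ≥ 0`, `m₀ ≥ 0`. [folklore] -/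
theorem mProfile_le (hm0 : 0 ≤ m₀) {A : ℝ} (hA : 0 ≤ A) : mProfile m₀ a₀ a₁ A ≤ A + m₀ := by
  rw [mProfile]
  have hs := smoothStep_mem_Icc a₀ a₁ A
  nlinarith [hs.1, hs.2]

/-- Smooth. [folklore] -/
theorem contDiff_mProfile (m₀ a₀ a₁ : ℝ) : ContDiff ℝ ∞ (mProfile m₀ a₀ a₁) := by
  unfold mProfile
  exact (contDiff_id.mul (contDiff_smoothStep _ _)).add (contDiff_const.mul (contDiff_const.sub (contDiff_smoothStep _ _)))

/-- The derivative of `m`: `m' = s + (A - m₀) s'`. [folklore] -/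
theorem hasDerivAt_mProfile (m₀ a₀ a₁ A : ℝ) :
    HasDerivAt (mProfile m₀ a₀ a₁) (smoothStep a₀ a₁ A + (A - m₀) * deriv (smoothStep a₀ a₁) A) A := by
  have hs := (differentiable_smoothStep a₀ a₁ A).hasDerivAt
  exact (((hasDerivAt_id' A).mul hs).add ((hs.const_sub 1).const_mul m₀)).congr_deriv (by ring)

/-- **`m' ≥ 0` when `m₀ ≤ a₀`.** [folklore] -/
theorem deriv_mProfile_nonneg (ha : a₀ < a₁) (hm : m₀ ≤ a₀) (A : ℝ) : 0 ≤ deriv (mProfile m₀ a₀ a₁) A := by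
  rw [(hasDerivAt_mProfile m₀ a₀ a₁ A).deriv]
  have hs := smoothStep_mem_Icc a₀ a₁ A
  by_cases hA : A < a₀
  · rw [deriv_smoothStep_of_lt ha hA, mul_zero, add_zero]; exact hs.1
  · push Not at hA
    exact add_nonneg hs.1 (mul_nonneg (by linarith) (deriv_smoothStep_nonneg ha A))

/-- **`m' ≤ 1 + 2C` on `[0, a₁]` when `0 ≤ m₀`, `a₁ = 2a₀ > 0`** (`|s'| ≤ C/(a₁ - a₀) = C/a₀` and `|A - m₀| ≤ a₁`). [folklore] -/
theorem deriv_mProfile_le (ha0 : 0 < a₀) (ha : a₁ = 2 * a₀) (hm0 : 0 ≤ m₀) (hm : m₀ ≤ a₀) {A : ℝ} (hA0 : 0 ≤ A) (hA : A ≤ a₁) :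
    deriv (mProfile m₀ a₀ a₁) A ≤ 1 + 2 * smoothTransitionDerivBound := by
  have ha' : a₀ < a₁ := by rw [ha]; linarith
  rw [(hasDerivAt_mProfile m₀ a₀ a₁ A).deriv]
  have hs := smoothStep_mem_Icc a₀ a₁ A
  have hd := deriv_smoothStep_le ha' A
  have hd0 := deriv_smoothStep_nonneg ha' A
  have hba : a₁ - a₀ = a₀ := by rw [ha]; ring
  rw [hba] at hd
  have habs : |A - m₀| ≤ 2 * a₀ := by
    rw [abs_le]; constructor <;> linarith
  have h2 : (A - m₀) * deriv (smoothStep a₀ a₁) A ≤ 2 * smoothTransitionDerivBound := by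
    calc (A - m₀) * deriv (smoothStep a₀ a₁) A ≤ |A - m₀| * deriv (smoothStep a₀ a₁) A :=
          mul_le_mul_of_nonneg_right (le_abs_self _) hd0
      _ ≤ (2 * a₀) * (smoothTransitionDerivBound / a₀) := mul_le_mul habs hd hd0 (by positivity)
      _ = 2 * smoothTransitionDerivBound := by field_simp
  linarith [hs.2]

/-- **`ρ = 1/A` on `[a₁, ∞)`.** [folklore] -/
theorem rhoProfile_of_ge (ha : a₀ < a₁) {A : ℝ} (hA : a₁ ≤ A) : rhoProfile m₀ a₀ a₁ A = A⁻¹ := by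
  rw [rhoProfile, mProfile_of_ge ha hA]

/-- **`ρ = 1/m₀ = ρ 0` on `(-∞, a₀]`** (`a₀ ≥ 0`). [folklore] -/
theorem rhoProfile_of_le (ha : a₀ < a₁) {A : ℝ} (hA : A ≤ a₀) : rhoProfile m₀ a₀ a₁ A = m₀⁻¹ := by
  rw [rhoProfile, mProfile_of_le ha hA]

/-- **`ρ > 0`** (`0 < m₀ ≤ a₀`). [folklore] -/
theorem rhoProfile_pos (ha : a₀ < a₁) (hm0 : 0 < m₀) (hm : m₀ ≤ a₀) (A : ℝ) : 0 < rhoProfile m₀ a₀ a₁ A :=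
  inv_pos.2 (lt_of_lt_of_le hm0 (le_mProfile ha hm A))

/-- `ρ ≤ 1/m₀` (`0 < m₀ ≤ a₀`). [folklore] -/
theorem rhoProfile_le (ha : a₀ < a₁) (hm0 : 0 < m₀) (hm : m₀ ≤ a₀) (A : ℝ) : rhoProfile m₀ a₀ a₁ A ≤ m₀⁻¹ :=
  inv_anti₀ hm0 (le_mProfile ha hm A)

/-- Smooth (`0 < m₀ ≤ a₀`). [folklore] -/
theorem contDiff_rhoProfile (ha : a₀ < a₁) (hm0 : 0 < m₀) (hm : m₀ ≤ a₀) : ContDiff ℝ ∞ (rhoProfile m₀ a₀ a₁) :=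
  (contDiff_mProfile m₀ a₀ a₁).inv fun A => (lt_of_lt_of_le hm0 (le_mProfile ha hm A)).ne'

/-- The derivative of `ρ = 1/m`: `ρ' = -m'/m²`. [folklore] -/
theorem hasDerivAt_rhoProfile (ha : a₀ < a₁) (hm0 : 0 < m₀) (hm : m₀ ≤ a₀) (A : ℝ) :
    HasDerivAt (rhoProfile m₀ a₀ a₁) (-(deriv (mProfile m₀ a₀ a₁) A) / (mProfile m₀ a₀ a₁ A) ^ 2) A := by
  have hm' := ((contDiff_mProfile m₀ a₀ a₁).differentiable (by simp) A).hasDerivAt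
  have hne : mProfile m₀ a₀ a₁ A ≠ 0 := (lt_of_lt_of_le hm0 (le_mProfile ha hm A)).ne'
  exact hm'.inv hne

/-- **`ρ' ≤ 0`** (`0 < m₀ ≤ a₀`). [folklore] -/
theorem deriv_rhoProfile_nonpos (ha : a₀ < a₁) (hm0 : 0 < m₀) (hm : m₀ ≤ a₀) (A : ℝ) : deriv (rhoProfile m₀ a₀ a₁) A ≤ 0 := by
  rw [(hasDerivAt_rhoProfile ha hm0 hm A).deriv]
  exact div_nonpos_of_nonpos_of_nonneg (by linarith [deriv_mProfile_nonneg ha hm A]) (sq_nonneg _)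

/-- **`|ρ + A ρ'| ≤ 16(3 + 2C)/a₁²·a₁ …`**: precisely, for `a₁ = 2a₀`, `m₀ = a₀ > 0` and
`A ∈ [0, 2a₁]`, `|ρ(A) + A ρ'(A)| ≤ (6 + 4C)/a₀`. [folklore] -/
theorem abs_rho_add_mul_deriv_le (ha0 : 0 < a₀) (ha : a₁ = 2 * a₀) {A : ℝ} (hA0 : 0 ≤ A) (hA : A ≤ a₁) :
    |rhoProfile a₀ a₀ a₁ A + A * deriv (rhoProfile a₀ a₀ a₁) A| ≤ (6 + 4 * smoothTransitionDerivBound) / a₀ := by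
  have ha' : a₀ < a₁ := by rw [ha]; linarith
  have hmlo : a₀ ≤ mProfile a₀ a₀ a₁ A := le_mProfile ha' le_rfl A
  have hmpos : 0 < mProfile a₀ a₀ a₁ A := lt_of_lt_of_le ha0 hmlo
  have hmhi : mProfile a₀ a₀ a₁ A ≤ 3 * a₀ := by have := mProfile_le (a₀ := a₀) (a₁ := a₁) ha0.le hA0; rw [ha] at hA; linarith
  have hd0 : 0 ≤ deriv (mProfile a₀ a₀ a₁) A := deriv_mProfile_nonneg ha' le_rfl A
  have hd1 : deriv (mProfile a₀ a₀ a₁) A ≤ 1 + 2 * smoothTransitionDerivBound := deriv_mProfile_le ha0 ha ha0.le le_rfl hA0 hA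
  rw [(hasDerivAt_rhoProfile ha' ha0 le_rfl A).deriv, rhoProfile]
  set m := mProfile a₀ a₀ a₁ A with hm
  set m' := deriv (mProfile a₀ a₀ a₁) A with hm'
  have hexpr : m⁻¹ + A * (-m' / m ^ 2) = (m - A * m') / m ^ 2 := by
    field_simp
    ring
  rw [hexpr, abs_div, abs_of_pos (pow_pos hmpos 2), div_le_div_iff₀ (pow_pos hmpos 2) ha0]
  have hnum : |m - A * m'| ≤ 3 * a₀ + 2 * a₀ * (1 + 2 * smoothTransitionDerivBound) := by
    rw [abs_le]
    have hA' : A ≤ 2 * a₀ := by rw [ha] at hA; exact hA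
    constructor
    · nlinarith [mul_nonneg hA0 hd0]
    · nlinarith [mul_nonneg hA0 hd0]
  have hC := smoothTransitionDerivBound_pos
  calc |m - A * m'| * a₀ ≤ (3 * a₀ + 2 * a₀ * (1 + 2 * smoothTransitionDerivBound)) * a₀ := mul_le_mul_of_nonneg_right hnum ha0.le
    _ = (5 + 4 * smoothTransitionDerivBound) * a₀ ^ 2 := by ring
    _ ≤ (6 + 4 * smoothTransitionDerivBound) * a₀ ^ 2 := by nlinarith [sq_nonneg a₀]
    _ ≤ (6 + 4 * smoothTransitionDerivBound) * m ^ 2 := by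
        apply mul_le_mul_of_nonneg_left _ (by linarith)
        nlinarith [hmlo, ha0]

end Rho

/-! ### The belt cut-off `χ_b` -/

/-- **The belt cut-off** `χ_b = stepDown a₀ a₁`. [cite: GayKirby2016, §4, Lemma 14] -/
def chibProfile (a₀ a₁ A : ℝ) : ℝ := stepDown a₀ a₁ A

section Chib

variable {a₀ a₁ : ℝ}

/-- `χ_b = χ_b 0 = 1` on `(-∞, a₀]` (`a₀ ≥ 0`). [folklore] -/
theorem chibProfile_of_le (ha : a₀ < a₁) {A : ℝ} (hA : A ≤ a₀) : chibProfile a₀ a₁ A = 1 := stepDown_of_le ha hA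

/-- `χ_b = 0` on `[a₁, ∞)`. [folklore] -/
theorem chibProfile_of_ge (ha : a₀ < a₁) {A : ℝ} (hA : a₁ ≤ A) : chibProfile a₀ a₁ A = 0 := stepDown_of_ge ha hA

/-- `|χ_b| ≤ 1`. [folklore] -/
theorem abs_chibProfile_le (a₀ a₁ A : ℝ) : |chibProfile a₀ a₁ A| ≤ 1 := by
  obtain ⟨h0, h1⟩ := stepDown_mem_Icc a₀ a₁ A
  rw [chibProfile, abs_le]; exact ⟨by linarith, h1⟩

/-- Smooth. [folklore] -/
theorem contDiff_chibProfile (a₀ a₁ : ℝ) : ContDiff ℝ ∞ (chibProfile a₀ a₁) := contDiff_stepDown a₀ a₁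

/-- `|χ_b'| ≤ C/(a₁ - a₀)`. [folklore] -/
theorem abs_deriv_chibProfile_le (ha : a₀ < a₁) (A : ℝ) : |deriv (chibProfile a₀ a₁) A| ≤ smoothTransitionDerivBound / (a₁ - a₀) := by
  rw [show chibProfile a₀ a₁ = stepDown a₀ a₁ from rfl]; exact abs_deriv_stepDown_le ha A

end Chib

/-! ### The radial correction `R₀` -/

/-- **The radial correction** `R₀(a) = S(a) exp(L(a_R' - a)) + (1 - S(a))`, `S = stepDown (a_R' - w₀) a_R'`:
`exp(L(a_R' - a))` on `(-∞, a_R' - w₀]`, `1` on `[a_R', ∞)`. [cite: GayKirby2016, §4, Lemma 14] -/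
def radialProfile (L aR' w₀ a : ℝ) : ℝ := stepDown (aR' - w₀) aR' a * Real.exp (L * (aR' - a)) + (1 - stepDown (aR' - w₀) aR' a)

section Radial

variable {L aR' w₀ : ℝ}

/-- **`R₀ = 1` on `[a_R', ∞)`.** [folklore] -/
theorem radialProfile_of_ge (hw : 0 < w₀) {a : ℝ} (ha : aR' ≤ a) : radialProfile L aR' w₀ a = 1 := by
  rw [radialProfile, stepDown_of_ge (by linarith) ha]; ring

/-- **`R₀ = exp(L(a_R' - a))` on `(-∞, a_R' - w₀]`.** [folklore] -/
theorem radialProfile_of_le (hw : 0 < w₀) {a : ℝ} (ha : a ≤ aR' - w₀) : radialProfile L aR' w₀ a = Real.exp (L * (aR' - a)) := by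
  rw [radialProfile, stepDown_of_le (by linarith) ha]; ring

/-- **`R₀ ≥ 1`** (`L ≥ 0`). [folklore] -/
theorem one_le_radialProfile (hw : 0 < w₀) (hL : 0 ≤ L) (a : ℝ) : 1 ≤ radialProfile L aR' w₀ a := by
  by_cases ha : aR' ≤ a
  · rw [radialProfile_of_ge hw ha]
  · push Not at ha
    have hexp : 1 ≤ Real.exp (L * (aR' - a)) := Real.one_le_exp (mul_nonneg hL (by linarith))
    have hs := stepDown_mem_Icc (aR' - w₀) aR' a
    rw [radialProfile]
    nlinarith [hs.1]

/-- `R₀ > 0` (`L ≥ 0`). [folklore] -/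
theorem radialProfile_pos (hw : 0 < w₀) (hL : 0 ≤ L) (a : ℝ) : 0 < radialProfile L aR' w₀ a :=
  lt_of_lt_of_le one_pos (one_le_radialProfile hw hL a)

/-- Smooth. [folklore] -/
theorem contDiff_radialProfile (L aR' w₀ : ℝ) : ContDiff ℝ ∞ (radialProfile L aR' w₀) := by
  unfold radialProfile
  exact ((contDiff_stepDown _ _).mul (Real.contDiff_exp.comp (contDiff_const.mul (contDiff_const.sub contDiff_id)))).add
    (contDiff_const.sub (contDiff_stepDown _ _))

/-- The derivative of `R₀`: `R₀' = S'(e - 1) - L S e`, `e = exp(L(a_R' - a))`. [folklore] -/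
theorem hasDerivAt_radialProfile (L aR' w₀ a : ℝ) :
    HasDerivAt (radialProfile L aR' w₀)
      (deriv (stepDown (aR' - w₀) aR') a * (Real.exp (L * (aR' - a)) - 1) -
        L * stepDown (aR' - w₀) aR' a * Real.exp (L * (aR' - a))) a := by
  have hs := (differentiable_stepDown (aR' - w₀) aR' a).hasDerivAt
  have he : HasDerivAt (fun x : ℝ => Real.exp (L * (aR' - x))) (Real.exp (L * (aR' - a)) * (-L)) a := by
    have hl : HasDerivAt (fun x : ℝ => L * (aR' - x)) (-L) a := by
      simpa using ((hasDerivAt_id a).const_sub aR').const_mul L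
    exact (Real.hasDerivAt_exp _).comp a hl
  exact ((hs.mul he).add (hs.const_sub 1)).congr_deriv (by ring)

/-- **`R₀' ≤ 0`** (`L ≥ 0`, `w₀ > 0`). [folklore] -/
theorem deriv_radialProfile_nonpos (hw : 0 < w₀) (hL : 0 ≤ L) (a : ℝ) : deriv (radialProfile L aR' w₀) a ≤ 0 := by
  rw [(hasDerivAt_radialProfile L aR' w₀ a).deriv]
  have hs := stepDown_mem_Icc (aR' - w₀) aR' a
  have hs' := deriv_stepDown_nonpos (show aR' - w₀ < aR' by linarith) a
  have hepos : 0 < Real.exp (L * (aR' - a)) := Real.exp_pos _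
  by_cases ha : a ≤ aR'
  · have hexp : 1 ≤ Real.exp (L * (aR' - a)) := Real.one_le_exp (mul_nonneg hL (by linarith))
    have h1 : deriv (stepDown (aR' - w₀) aR') a * (Real.exp (L * (aR' - a)) - 1) ≤ 0 :=
      mul_nonpos_of_nonpos_of_nonneg hs' (by linarith)
    have h2 : 0 ≤ L * stepDown (aR' - w₀) aR' a * Real.exp (L * (aR' - a)) :=
      mul_nonneg (mul_nonneg hL hs.1) hepos.le
    linarith
  · push Not at ha
    rw [deriv_stepDown, deriv_smoothStep_of_gt (by linarith) ha, stepDown_of_ge (by linarith) ha.le]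
    simp

/-- **On `(-∞, a_R' - w₀)` the logarithmic derivative is `-L`**: `R₀' = -L R₀` there. [folklore] -/
theorem deriv_radialProfile_of_lt (hw : 0 < w₀) {a : ℝ} (ha : a < aR' - w₀) :
    deriv (radialProfile L aR' w₀) a = -L * radialProfile L aR' w₀ a := by
  have heq : radialProfile L aR' w₀ =ᶠ[𝓝 a] fun x => Real.exp (L * (aR' - x)) :=
    Filter.eventuallyEq_of_mem (Iio_mem_nhds ha) fun x hx => radialProfile_of_le hw (le_of_lt hx)
  rw [heq.deriv_eq, radialProfile_of_le hw ha.le]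
  have hl : HasDerivAt (fun x : ℝ => L * (aR' - x)) (-L) a := by
    simpa using ((hasDerivAt_id a).const_sub aR').const_mul L
  have hd : HasDerivAt (fun x : ℝ => Real.exp (L * (aR' - x))) (Real.exp (L * (aR' - a)) * (-L)) a :=
    (Real.hasDerivAt_exp _).comp a hl
  rw [hd.deriv]
  ring

end Radial

/-! ### The outer factor `U` of the first and third sector functions -/

/-- **The outer factor** `U(u) = u + (1 - u) smoothStep u₀ u₁ u`: the identity on `(-∞, u₀]`,
`1` on `[u₁, ∞)`. [cite: GayKirby2016, §4, Lemma 14] -/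
def uProfile (u₀ u₁ u : ℝ) : ℝ := u + (1 - u) * smoothStep u₀ u₁ u

section U

variable {u₀ u₁ : ℝ}

/-- **`U = id` on `(-∞, u₀]`.** [folklore] -/
theorem uProfile_of_le (hu : u₀ < u₁) {u : ℝ} (h : u ≤ u₀) : uProfile u₀ u₁ u = u := by
  rw [uProfile, smoothStep_of_le hu h]; ring

/-- **`U = 1` on `[u₁, ∞)`.** [folklore] -/
theorem uProfile_of_ge (hu : u₀ < u₁) {u : ℝ} (h : u₁ ≤ u) : uProfile u₀ u₁ u = 1 := by
  rw [uProfile, smoothStep_of_ge hu h]; ring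

/-- Smooth. [folklore] -/
theorem contDiff_uProfile (u₀ u₁ : ℝ) : ContDiff ℝ ∞ (uProfile u₀ u₁) := by
  unfold uProfile
  exact contDiff_id.add ((contDiff_const.sub contDiff_id).mul (contDiff_smoothStep _ _))

/-- **`U > 0` on `(0, ∞)`** (`u₁ ≤ 1`). [folklore] -/
theorem uProfile_pos (hu : u₀ < u₁) (hu1 : u₁ ≤ 1) {u : ℝ} (h : 0 < u) : 0 < uProfile u₀ u₁ u := by
  rw [uProfile]
  have hs := smoothStep_mem_Icc u₀ u₁ u
  by_cases hle : u ≤ 1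
  · nlinarith [hs.1, hs.2]
  · push Not at hle
    rw [smoothStep_of_ge hu (by linarith)]; linarith

/-- The derivative of `U`: `U' = 1 - s + (1 - u) s'`. [folklore] -/
theorem hasDerivAt_uProfile (u₀ u₁ u : ℝ) :
    HasDerivAt (uProfile u₀ u₁) (1 - smoothStep u₀ u₁ u + (1 - u) * deriv (smoothStep u₀ u₁) u) u := by
  have hs := (differentiable_smoothStep u₀ u₁ u).hasDerivAt
  exact ((hasDerivAt_id' u).add (((hasDerivAt_id' u).const_sub 1).mul hs)).congr_deriv (by ring)

/-- **`U' ≥ 0`** (`u₁ ≤ 1`). [folklore] -/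
theorem deriv_uProfile_nonneg (hu : u₀ < u₁) (hu1 : u₁ ≤ 1) (u : ℝ) : 0 ≤ deriv (uProfile u₀ u₁) u := by
  rw [(hasDerivAt_uProfile u₀ u₁ u).deriv]
  have hs := smoothStep_mem_Icc u₀ u₁ u
  by_cases hle : u ≤ u₁
  · exact add_nonneg (by linarith [hs.2]) (mul_nonneg (by linarith) (deriv_smoothStep_nonneg hu u))
  · push Not at hle
    rw [deriv_smoothStep_of_gt hu hle, mul_zero, add_zero]; linarith [hs.2]

/-- `U' = 1` on `(-∞, u₀)`. [folklore] -/
theorem deriv_uProfile_of_lt (hu : u₀ < u₁) {u : ℝ} (h : u < u₀) : deriv (uProfile u₀ u₁) u = 1 := by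
  have heq : uProfile u₀ u₁ =ᶠ[𝓝 u] fun x => x :=
    Filter.eventuallyEq_of_mem (Iio_mem_nhds h) fun x hx => uProfile_of_le hu (le_of_lt hx)
  rw [heq.deriv_eq, deriv_id'']

/-- **The face condition**: for `u, v ≥ 0` not both zero, `U'(u) v + U(u) > 0` (`u₀ > 0`,
`u₁ ≤ 1`; the partner profile being the identity). [folklore] -/
theorem uProfile_face (hu0 : 0 < u₀) (hu : u₀ < u₁) (hu1 : u₁ ≤ 1) {u v : ℝ} (hu' : 0 ≤ u) (hv : 0 ≤ v) (h : 0 < u ∨ 0 < v) :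
    0 < deriv (uProfile u₀ u₁) u * v + uProfile u₀ u₁ u * 1 := by
  rcases h with h | h
  · have h1 : 0 ≤ deriv (uProfile u₀ u₁) u * v := mul_nonneg (deriv_uProfile_nonneg hu hu1 u) hv
    have h2 := uProfile_pos hu hu1 h
    linarith
  · rcases hu'.lt_or_eq with hupos | hu0'
    · have h1 : 0 ≤ deriv (uProfile u₀ u₁) u * v := mul_nonneg (deriv_uProfile_nonneg hu hu1 u) hv
      have h2 := uProfile_pos hu hu1 hupos
      linarith
    · rw [← hu0', deriv_uProfile_of_lt hu hu0, uProfile_of_le hu hu0.le]; linarith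

end U

end TriProfile

end Literature.Topology.FourManifolds

end
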